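import Summits.CriticalPhenomena.SAWScalingLimit.Theorems.SubseqIdentification.Negative.ProbabilityRedundant
import Summits.CriticalPhenomena.SAWScalingLimit.Theorems.SubseqIdentification.Negative.CoincidentEndpointLaw
import Summits.CriticalPhenomena.SAWScalingLimit.Theorems.SubseqIdentification.Negative.Necessity

/-!
# Crux `SubseqIdentification` (stmt-CriticalPhenomena-0783) — where the reversibility debt is due: NON-VACUITY

Companion of `Reversal.lean` (cdisprove cycle 2). "The hypotheses of the crux are satisfiable on `D`"
(some endpoint approximation, mesh sequence `s → 0⁺` and probability measure `μ` with
`∫ f∘curve dP_{s n} → ∫ f dμ` for all bounded continuous `f`) holds on every Dobrushin domain with an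
endpoint approximation as soon as the pushed-forward critical SAW laws are tight along the mesh
(Prokhorov past the junk meshes, `exists_subseqConv_of_isTightAlongMesh`), in particular under the
route's target item `EventualTight` (stmt-CriticalPhenomena-1372; `hasSubseqLimit_of_eventualTight`).
Consequently `EventualTight ∧ SubseqIdentification` proves Zhan's reversibility of chordal SLE_{8/3}
on all such domains (`ReversalUnderTightness.lean`). Under the conjunct itself every such domain
carries a limit (`hasSubseqLimit_of_sawScalingLimit`). Unconditionally NO Dobrushin domain is known to carry a subsequential SAW limit (tightness of
the critical `ℤ²` SAW along one mesh sequence is open): the crux cannot at present be tested on a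
single instance — it is non-vacuous exactly where (a sequential weakening of) `EventualTight` holds.
-/

noncomputable section

open Literature.Probability.RandomPlanarGeometry Literature.Probability.RandomPlanarGeometry.SAW
  Literature.Probability.LatticeModels Literature.Probability.Percolation Literature.Probability
  MeasureTheory Filter Topology Set
open scoped NNReal ENNReal BoundedContinuousFunction

namespace Summit.CriticalPhenomena.SAWScalingLimit.Theorems.SubseqIdentification.Negative

/-! ## Non-vacuity of the crux on `D` = tightness along the mesh (Prokhorov) -/

section NonVacuity

variable {D : DobrushinDomain} {a b : ℝ → Site 2}

open Summit.CriticalPhenomena.SAWScalingLimit.Theses.SAWRenewalTightness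

/-- **Prokhorov along the mesh for the SAW laws.** If the pushed-forward critical SAW laws of
`(D; a_δ, b_δ)` are tight along `δ → 0⁺` (`IsTightAlongMesh`), then along every mesh sequence
`s → 0⁺` a subsequence converges to a probability measure: the hypotheses of the crux are then
satisfiable. (The laws are probability measures only eventually; we shift past the junk meshes
using `eventually_isProbabilityMeasure_law`.) [folklore] -/
theorem exists_subseqConv_of_isTightAlongMesh (hab : IsEndpointApprox D a b)
    (hT : IsTightAlongMesh (fun δ (γ : DomainSAW D.carrier δ (a δ) (b δ)) => γ.curve)
      (fun δ => law D.carrier δ (a δ) (b δ)))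
    {s : ℕ → ℝ} (hs : Tendsto s atTop (𝓝[>] (0 : ℝ))) :
    ∃ (φ : ℕ → ℕ) (μ : Measure (CurveClass ℂ)), StrictMono φ ∧ IsProbabilityMeasure μ ∧
      ∀ f : CurveClass ℂ →ᵇ ℝ, Tendsto (fun n => ∫ γ, f γ.curve
        ∂(law D.carrier (s (φ n)) (a (s (φ n))) (b (s (φ n))))) atTop (𝓝 (∫ x, f x ∂μ)) := by
  -- past some index the laws are probability measures
  obtain ⟨N, hN⟩ := eventually_atTop.1 (hs.eventually (eventually_isProbabilityMeasure_law hab))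
  have hN' : ∀ n, IsProbabilityMeasure (law D.carrier (s (n + N)) (a (s (n + N))) (b (s (n + N)))) :=
    fun n => hN _ (N.le_add_left n)
  let ν : ℕ → ProbabilityMeasure (CurveClass ℂ) := fun n =>
    ⟨(law D.carrier (s (n + N)) (a (s (n + N))) (b (s (n + N)))).map (fun γ => γ.curve),
      Measure.isProbabilityMeasure_map (DomainSAW.measurable_of_top _).aemeasurable⟩
  have hνapply : ∀ n (K : Set (CurveClass ℂ)), IsClosed K → (ν n : Measure (CurveClass ℂ)) Kᶜ =
      law D.carrier (s (n + N)) (a (s (n + N))) (b (s (n + N))) ((fun γ => γ.curve) ⁻¹' Kᶜ) :=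
    fun n K hK => Measure.map_apply (DomainSAW.measurable_of_top _) hK.isOpen_compl.measurableSet
  have htight : IsTightMeasureSet
      {((μ : ProbabilityMeasure (CurveClass ℂ)) : Measure (CurveClass ℂ)) | μ ∈ Set.range ν} := by
    have hrange : {((μ : ProbabilityMeasure (CurveClass ℂ)) : Measure (CurveClass ℂ)) | μ ∈ Set.range ν}
        = Set.range (fun n => (ν n : Measure (CurveClass ℂ))) := by
      ext x
      simp only [Set.mem_range, Set.mem_setOf_eq]
      constructor
      · rintro ⟨μ, ⟨n, rfl⟩, rfl⟩
        exact ⟨n, rfl⟩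
      · rintro ⟨n, rfl⟩
        exact ⟨ν n, ⟨n, rfl⟩, rfl⟩
    rw [hrange]
    haveI : ∀ n, IsFiniteMeasure ((fun n => (ν n : Measure (CurveClass ℂ))) n) := fun n => by
      change IsFiniteMeasure (ν n : Measure (CurveClass ℂ))
      infer_instance
    refine isTightMeasureSet_range_of_eventually fun ε hε => ?_
    obtain ⟨K, hK, hev⟩ := hT ε hε
    refine ⟨K, hK, ?_⟩
    have hs' : Tendsto (fun n => s (n + N)) atTop (𝓝[>] (0 : ℝ)) := hs.comp (tendsto_add_atTop_nat N)
    filter_upwards [hs'.eventually hev] with n hn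
    rwa [hνapply n K hK.isClosed]
  have hcomp := isCompact_closure_of_isTightMeasureSet htight
  obtain ⟨μ, -, φ, hφ, hlim⟩ := hcomp.isSeqCompact fun n => subset_closure (Set.mem_range_self n)
  refine ⟨fun n => φ n + N, μ, fun m n hmn => Nat.add_lt_add_right (hφ hmn) N, inferInstance,
    fun f => ?_⟩
  have := (ProbabilityMeasure.tendsto_iff_forall_integral_tendsto.1 hlim) f
  refine this.congr fun n => ?_
  change ∫ x, f x ∂((law D.carrier (s (φ n + N)) (a (s (φ n + N))) (b (s (φ n + N)))).map
    (fun γ => γ.curve)) = _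
  exact integral_map (DomainSAW.measurable_of_top _).aemeasurable f.continuous.aestronglyMeasurable

/-- Tightness of the SAW laws of one Dobrushin domain with one endpoint approximation makes the
crux NON-VACUOUS there (its hypotheses are satisfiable on `D`). [folklore] -/
theorem hasSubseqLimit_of_isTightAlongMesh (hab : IsEndpointApprox D a b)
    (hT : IsTightAlongMesh (fun δ (γ : DomainSAW D.carrier δ (a δ) (b δ)) => γ.curve)
      (fun δ => law D.carrier δ (a δ) (b δ))) :
    (∃ (a b : ℝ → Site 2) (s : ℕ → ℝ) (μ : Measure (CurveClass ℂ)), IsEndpointApprox D a b ∧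
      Tendsto s atTop (𝓝[>] (0 : ℝ)) ∧ IsProbabilityMeasure μ ∧
      (∀ f : CurveClass ℂ →ᵇ ℝ, Tendsto (fun n => ∫ γ, f γ.curve ∂(law D.carrier (s n) (a (s n)) (b (s n)))) atTop (𝓝 (∫ x, f x ∂μ)))) := by
  have hs : Tendsto (fun n : ℕ => 1 / ((n : ℝ) + 1)) atTop (𝓝[>] (0 : ℝ)) :=
    tendsto_nhdsWithin_iff.2 ⟨tendsto_one_div_add_atTop_nhds_zero_nat,
      Eventually.of_forall fun n => Set.mem_Ioi.2 Nat.one_div_pos_of_nat⟩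
  obtain ⟨φ, μ, hφ, hμ, hlim⟩ := exists_subseqConv_of_isTightAlongMesh hab hT hs
  exact ⟨a, b, _, μ, hab, hs.comp hφ.tendsto_atTop, hμ, hlim⟩

/-- The route's `EventualTight` (item stmt-CriticalPhenomena-1372, set-level tightness on an
initial mesh interval) gives tightness along the mesh for every endpoint approximation. [folklore] -/
theorem isTightAlongMesh_of_eventualTight (hT : EventualTight) (hab : IsEndpointApprox D a b) :
    IsTightAlongMesh (fun δ (γ : DomainSAW D.carrier δ (a δ) (b δ)) => γ.curve)
      (fun δ => law D.carrier δ (a δ) (b δ)) := by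
  obtain ⟨δ₀, hδ₀, h⟩ := hT D a b hab
  exact isTightAlongMesh_of_isTightMeasureSet_image
    (Eventually.of_forall fun δ => (DomainSAW.measurable_of_top _).aemeasurable) hδ₀ h

/-- Under `EventualTight`, every Dobrushin domain with an endpoint approximation carries a
subsequential SAW limit, so the reversibility debt of §3 is due on all of them. [folklore] -/
theorem hasSubseqLimit_of_eventualTight (hT : EventualTight) (hab : IsEndpointApprox D a b) :
    (∃ (a b : ℝ → Site 2) (s : ℕ → ℝ) (μ : Measure (CurveClass ℂ)), IsEndpointApprox D a b ∧
      Tendsto s atTop (𝓝[>] (0 : ℝ)) ∧ IsProbabilityMeasure μ ∧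
      (∀ f : CurveClass ℂ →ᵇ ℝ, Tendsto (fun n => ∫ γ, f γ.curve ∂(law D.carrier (s n) (a (s n)) (b (s n)))) atTop (𝓝 (∫ x, f x ∂μ)))) :=
  hasSubseqLimit_of_isTightAlongMesh hab (isTightAlongMesh_of_eventualTight hT hab)

/-- **Non-vacuity status (remark with trivial formal content).** The hypotheses of the crux are
satisfiable on `D` iff some endpoint approximation has ONE weakly convergent mesh sequence; a
convergent sequence of probability measures on the Polish space `CurveClass ℂ` is tight, and
conversely one tight sequence yields a convergent subsequence (`exists_subseqConv_of_isTightAlongMesh`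
is the filter version). No Dobrushin domain is currently KNOWN to carry such a limit (tightness of
the critical `ℤ²` SAW along a single sequence is open), so the crux cannot at present be tested on
one instance: it is non-vacuous exactly where the companion item `EventualTight` (or a sequential
weakening of it) holds. Formal content recorded: under `EventualTight` the unit disc carries a
subsequential limit. [folklore] -/
theorem hasSubseqLimit_unitDisc_of_eventualTight (hT : EventualTight) :
    (∃ (a b : ℝ → Site 2) (s : ℕ → ℝ) (μ : Measure (CurveClass ℂ)), IsEndpointApprox DobrushinDomain.unitDisc a b ∧
      Tendsto s atTop (𝓝[>] (0 : ℝ)) ∧ IsProbabilityMeasure μ ∧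
      (∀ f : CurveClass ℂ →ᵇ ℝ, Tendsto (fun n => ∫ γ, f γ.curve ∂(law DobrushinDomain.unitDisc.carrier (s n) (a (s n)) (b (s n)))) atTop (𝓝 (∫ x, f x ∂μ)))) :=
  hasSubseqLimit_of_eventualTight hT isEndpointApprox_std

/-- Under the conjunct itself, every Dobrushin domain with an endpoint approximation carries a
subsequential limit (convergence along `𝓝[>] 0` restricted to `s n = 1/(n+1)`); so if the LSW
conjecture is true the reversibility debt of `Reversal.lean` is due on all such domains. [folklore] -/
theorem hasSubseqLimit_of_sawScalingLimit (h : SAW.SAWScalingLimit) (hab : IsEndpointApprox D a b) :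
    ∃ (a b : ℝ → Site 2) (s : ℕ → ℝ) (μ : Measure (CurveClass ℂ)), IsEndpointApprox D a b ∧
      Tendsto s atTop (𝓝[>] (0 : ℝ)) ∧ IsProbabilityMeasure μ ∧
      (∀ f : CurveClass ℂ →ᵇ ℝ, Tendsto (fun n => ∫ γ, f γ.curve
        ∂(law D.carrier (s n) (a (s n)) (b (s n)))) atTop (𝓝 (∫ x, f x ∂μ))) := by
  obtain ⟨Γ, hΓ, -, hT⟩ := h D a b hab
  haveI := isProbabilityMeasure_preWienerMeasure'
  haveI : IsProbabilityMeasure (Process.preWienerMeasure.map Γ) :=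
    Measure.isProbabilityMeasure_map hΓ.aemeasurable
  refine ⟨a, b, fun n => 1 / ((n : ℝ) + 1), Process.preWienerMeasure.map Γ, hab,
    tendsto_inv_succ_nhdsGT, inferInstance, fun f => ?_⟩
  rw [integral_map hΓ.aemeasurable f.continuous.aestronglyMeasurable]
  exact (hT f).comp tendsto_inv_succ_nhdsGT

end NonVacuity

end Summit.CriticalPhenomena.SAWScalingLimit.Theorems.SubseqIdentification.Negative
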